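import Summits.CriticalPhenomena.PercolationContinuityZ3.Theorems.PercNearOneGluingNoHeavyLowerTailAttachmentMonotonicity
import Summits.CriticalPhenomena.PercolationContinuityZ3.Theorems.PercNearOneGluingNoHeavyLowerTailRankedSelection
import Literature.Probability.Percolation.BlockExplorationBasic
import HarnessLib

/-!
# `NoHeavyLowerTail` (stmt-CriticalPhenomena-4575) — coin reduction of the pattern-lightest bound, part 3a:
# the attachment pattern under gluing a coin, ranked selection, and the glued-coin branch

Support file (prover `prim-hp-8`, PL programme / coin reduction; `--supports stmt-CriticalPhenomena-4575`).
No definitions, no named facts, no sorries.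

`μ = prodBernoulli v` on `Fin n`, relays `A`, observer `o ∉ A`, level `j`.  The ATTACHMENT PATTERN of `o` (as in the registered
stub `stub_patternLightest`) is `π⁰(ω) = A.filter (fun b => ω ∈ openConnIn ((↑A)ᶜ ∪ {b}) o b)` — the relays reached from `o` by an
open path whose interior avoids `A`.  A RANKING is `r : Fin n → ℕ`, injective on `A`; the selected relay is the `r`-minimal
attached one: `Sel_b = {b ∈ π⁰ ∧ ∀ b' ∈ A, r b' < r b → b' ∉ π⁰}`.  The PATTERN-LIGHTEST FUNCTIONAL is
`Φ_r(v) = Σ_{b∈A} μ_v(Sel_b)·μ_v(R_b) − μ_v(1 ≤ N ≤ j)`; `Φ_r(v) ≥ 0` is the pattern-lightest bound with selection `r`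
(it implies the cumulative isolation lemma, `PatternLightest.le_champion_of_patternBound`).

* `pattern_insert` — gluing the coin `o–c` (`c ∈ A`) adds exactly `c` to the pattern: `π⁰(ω ∪ {oc}) = insert c (π⁰ ω)`
  (locality of `openConnIn`, `BlockExploration.openConnIn_of_agree`).
* `sel_insert_of_lt` / `sel_insert_of_gt` / `sel_self_insert_iff` — the selected relay after gluing the coin.
* `gluedCoin_nonneg` — if `v s(o,c) = 1` and the ranking is compatible with lightness in `H` (= `v` with the pairs at `o`
  switched off: `r b < r b' → μ_H(R_{b'}) ≤ μ_H(R_b)`), then `Φ_r(v) ≥ 0`.  (Almost surely `c` is attached, so only relays ranked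
  `≤ c` are ever selected, and each of them is at least as light-prone as `c` in `μ_v` by attachment monotonicity
  `CoinReduction.attachmentMono`; while `μ_v(1 ≤ N ≤ j) = μ_v(R_c)`.)

Memo PROOF-COIN-REDUCTION.md on the item (§1–2, §5).
-/

noncomputable section

namespace Summit.CriticalPhenomena.PercolationContinuityZ3.Theorems

namespace CoinReduction

open MeasureTheory Set Literature.Probability.LatticeModels Literature.Probability.Percolation
open scoped Classical BigOperators

variable {n : ℕ}

/-! ### The pattern under gluing a coin -/

/-- For `b ≠ c` with `c ∈ A`, the pair `s(o,c)` has an endpoint outside `(↑A)ᶜ ∪ {b}`, so `{o ↔ b in (↑A)ᶜ ∪ {b}}` does not see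
it: `insert s(o,c) ω ∈ openConnIn ((↑A)ᶜ ∪ {b}) o b ↔ ω ∈ openConnIn ((↑A)ᶜ ∪ {b}) o b`. [folklore] -/
theorem openConnIn_insert_coin_iff (ω : BondConfig (Fin n)) (A : Finset (Fin n)) {o c b : Fin n} (hcA : c ∈ A)
    (hbc : b ≠ c) :
    insert s(o, c) ω ∈ openConnIn ((↑A : Set (Fin n))ᶜ ∪ {b}) o b ↔
      ω ∈ openConnIn ((↑A : Set (Fin n))ᶜ ∪ {b}) o b := by
  have hcS : c ∉ ((↑A : Set (Fin n))ᶜ ∪ {b} : Set (Fin n)) := by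
    intro h
    rcases h with h | h
    · exact h (Finset.mem_coe.2 hcA)
    · exact hbc (mem_singleton_iff.1 h).symm
  constructor
  · intro h
    refine BlockExploration.openConnIn_of_agree h ?_
    intro a ha a' ha' hmem
    rcases mem_insert_iff.1 hmem with heq | hω
    · exfalso
      have hc : c ∈ s(a, a') := by rw [heq]; exact Sym2.mem_mk_right o c
      rcases Sym2.mem_iff.1 hc with rfl | rfl
      · exact hcS ha
      · exact hcS ha'
    · exact hω
  · intro h
    exact BlockExploration.openConnIn_of_agree h fun a _ a' _ hmem => mem_insert_of_mem _ hmem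

/-- Gluing the coin `o–c` attaches `c` directly: `insert s(o,c) ω ∈ openConnIn ((↑A)ᶜ ∪ {c}) o c` for `o ∉ A`, `o ≠ c`.
[folklore] -/
theorem openConnIn_insert_coin_self (ω : BondConfig (Fin n)) (A : Finset (Fin n)) {o c : Fin n} (hoA : o ∉ A)
    (hoc : o ≠ c) : insert s(o, c) ω ∈ openConnIn ((↑A : Set (Fin n))ᶜ ∪ {c}) o c := by
  rw [mem_openConnIn_iff_pathIn]
  refine PathIn.of_adj (Or.inl fun h => hoA (Finset.mem_coe.1 h)) (Or.inr (mem_singleton _)) ?_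
  rw [openGraph_adj]
  exact ⟨mem_insert _ _, hoc⟩

/-- **The pattern under gluing a coin.**  For `o ∉ A`, `c ∈ A`:
`π⁰(insert s(o,c) ω) = insert c (π⁰ ω)`. [folklore] -/
theorem pattern_insert (ω : BondConfig (Fin n)) (A : Finset (Fin n)) {o c : Fin n} (hoA : o ∉ A) (hcA : c ∈ A) :
    (A.filter fun b => insert s(o, c) ω ∈ openConnIn ((↑A : Set (Fin n))ᶜ ∪ {b}) o b) =
      insert c (A.filter fun b => ω ∈ openConnIn ((↑A : Set (Fin n))ᶜ ∪ {b}) o b) := by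
  have hoc : o ≠ c := fun h => hoA (h ▸ hcA)
  ext b
  simp only [Finset.mem_filter, Finset.mem_insert]
  constructor
  · rintro ⟨hbA, hb⟩
    by_cases hbc : b = c
    · exact Or.inl hbc
    · exact Or.inr ⟨hbA, (openConnIn_insert_coin_iff ω A hcA hbc).1 hb⟩
  · rintro (rfl | ⟨hbA, hb⟩)
    · exact ⟨hcA, openConnIn_insert_coin_self ω A hoA hoc⟩
    · by_cases hbc : b = c
      · subst hbc; exact ⟨hbA, openConnIn_insert_coin_self ω A hoA hoc⟩
      · exact ⟨hbA, (openConnIn_insert_coin_iff ω A hcA hbc).2 hb⟩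

/-! ### Ranked selection -/

/-- A relay ranked BELOW `c` is selected after gluing the coin `o–c` iff it was selected before. [folklore] -/
theorem sel_insert_of_lt (ω : BondConfig (Fin n)) (A : Finset (Fin n)) (r : Fin n → ℕ) {o c b : Fin n}
    (hoA : o ∉ A) (hcA : c ∈ A) (hlt : r b < r c) :
    insert s(o, c) ω ∈ {ω : BondConfig (Fin n) |
        b ∈ (A.filter fun b' => ω ∈ openConnIn ((↑A : Set (Fin n))ᶜ ∪ {b'}) o b') ∧
        ∀ b' ∈ A, r b' < r b → b' ∉ (A.filter fun b'' => ω ∈ openConnIn ((↑A : Set (Fin n))ᶜ ∪ {b''}) o b'')} ↔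
      ω ∈ {ω : BondConfig (Fin n) |
        b ∈ (A.filter fun b' => ω ∈ openConnIn ((↑A : Set (Fin n))ᶜ ∪ {b'}) o b') ∧
        ∀ b' ∈ A, r b' < r b → b' ∉ (A.filter fun b'' => ω ∈ openConnIn ((↑A : Set (Fin n))ᶜ ∪ {b''}) o b'')} := by
  have hbc : b ≠ c := fun h => lt_irrefl _ (h ▸ hlt)
  simp only [mem_setOf_eq, pattern_insert ω A hoA hcA, Finset.mem_insert]
  constructor
  · rintro ⟨hb, hall⟩
    refine ⟨hb.resolve_left hbc, fun b' hb'A hb'lt h => hall b' hb'A hb'lt (Or.inr h)⟩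
  · rintro ⟨hb, hall⟩
    refine ⟨Or.inr hb, fun b' hb'A hb'lt h => ?_⟩
    rcases h with h | h
    · exact lt_irrefl _ (lt_trans (h ▸ hb'lt) hlt)
    · exact hall b' hb'A hb'lt h

/-- A relay ranked ABOVE `c` is never selected after gluing the coin `o–c`. [folklore] -/
theorem sel_insert_of_gt (ω : BondConfig (Fin n)) (A : Finset (Fin n)) (r : Fin n → ℕ) {o c b : Fin n}
    (hoA : o ∉ A) (hcA : c ∈ A) (hgt : r c < r b) :
    insert s(o, c) ω ∉ {ω : BondConfig (Fin n) |
        b ∈ (A.filter fun b' => ω ∈ openConnIn ((↑A : Set (Fin n))ᶜ ∪ {b'}) o b') ∧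
        ∀ b' ∈ A, r b' < r b → b' ∉ (A.filter fun b'' => ω ∈ openConnIn ((↑A : Set (Fin n))ᶜ ∪ {b''}) o b'')} := by
  simp only [mem_setOf_eq, pattern_insert ω A hoA hcA, Finset.mem_insert, not_and]
  intro _ hall
  exact hall c hcA hgt (Or.inl rfl)

/-- After gluing the coin `o–c`, `c` is selected iff no relay ranked above `c` was attached. [folklore] -/
theorem sel_self_insert_iff (ω : BondConfig (Fin n)) (A : Finset (Fin n)) (r : Fin n → ℕ) {o c : Fin n}
    (hoA : o ∉ A) (hcA : c ∈ A) :
    insert s(o, c) ω ∈ {ω : BondConfig (Fin n) |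
        c ∈ (A.filter fun b' => ω ∈ openConnIn ((↑A : Set (Fin n))ᶜ ∪ {b'}) o b') ∧
        ∀ b' ∈ A, r b' < r c → b' ∉ (A.filter fun b'' => ω ∈ openConnIn ((↑A : Set (Fin n))ᶜ ∪ {b''}) o b'')} ↔
      ∀ b' ∈ A, r b' < r c → b' ∉ (A.filter fun b'' => ω ∈ openConnIn ((↑A : Set (Fin n))ᶜ ∪ {b''}) o b'') := by
  simp only [mem_setOf_eq, pattern_insert ω A hoA hcA]
  constructor
  · rintro ⟨_, hall⟩ b' hb'A hb'lt h
    exact hall b' hb'A hb'lt (Finset.mem_insert_of_mem h)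
  · intro hall
    refine ⟨Finset.mem_insert_self _ _, fun b' hb'A hb'lt h => ?_⟩
    rcases Finset.mem_insert.1 h with h | h
    · exact lt_irrefl _ (h ▸ hb'lt)
    · exact hall b' hb'A hb'lt h

/-! ### The glued-coin branch of the one-bond expansion is nonnegative -/

/-- **The pattern-lightest functional is nonnegative when the observer is glued to a relay.**  `o ∉ A`, `c ∈ A`,
`v s(o,c) = 1`, `r` injective on `A` and compatible with lightness in `H` (`v` with the pairs at `o` switched off).  Then
`μ_v(1 ≤ N ≤ j) ≤ Σ_{b ∈ A} μ_v(Sel_b) · μ_v(R_b)`. [folklore — via `CoinReduction.attachmentMono` (BHK 1.5)] -/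
theorem gluedCoin_nonneg (v : Sym2 (Fin n) → unitInterval) (A : Finset (Fin n)) (j : ℕ) {o c : Fin n}
    (r : Fin n → ℕ) (hr : Set.InjOn r ↑A) (hoA : o ∉ A) (hcA : c ∈ A) (hvc : v s(o, c) = 1)
    (hcompat : ∀ b ∈ A, ∀ b' ∈ A, r b < r b' →
      (prodBernoulli fun e : Sym2 (Fin n) => if e ∈ {e : Sym2 (Fin n) | o ∉ e} then v e else 0).real
          {ω : BondConfig (Fin n) | (A.filter fun z => ω ∈ openConn b' z).card ≤ j} ≤
        (prodBernoulli fun e : Sym2 (Fin n) => if e ∈ {e : Sym2 (Fin n) | o ∉ e} then v e else 0).real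
          {ω : BondConfig (Fin n) | (A.filter fun z => ω ∈ openConn b z).card ≤ j}) :
    (prodBernoulli v).real {ω : BondConfig (Fin n) |
        1 ≤ (A.filter fun z => ω ∈ openConn o z).card ∧ (A.filter fun z => ω ∈ openConn o z).card ≤ j} ≤
      ∑ b ∈ A, (prodBernoulli v).real {ω : BondConfig (Fin n) |
          b ∈ (A.filter fun b' => ω ∈ openConnIn ((↑A : Set (Fin n))ᶜ ∪ {b'}) o b') ∧
          ∀ b' ∈ A, r b' < r b → b' ∉ (A.filter fun b'' => ω ∈ openConnIn ((↑A : Set (Fin n))ᶜ ∪ {b''}) o b'')} *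
        (prodBernoulli v).real {ω : BondConfig (Fin n) | (A.filter fun z => ω ∈ openConn b z).card ≤ j} := by
  set μ := prodBernoulli v with hμ
  have hco : c ≠ o := fun h => hoA (h ▸ hcA)
  set pat : BondConfig (Fin n) → Finset (Fin n) :=
    fun ω => A.filter fun b' => ω ∈ openConnIn ((↑A : Set (Fin n))ᶜ ∪ {b'}) o b' with hpat
  set Sel : Fin n → Set (BondConfig (Fin n)) := fun b => {ω | b ∈ pat ω ∧ ∀ b' ∈ A, r b' < r b → b' ∉ pat ω} with hSel
  set R : Fin n → Set (BondConfig (Fin n)) := fun b => {ω | (A.filter fun z => ω ∈ openConn b z).card ≤ j} with hR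
  set L : Set (BondConfig (Fin n)) := {ω | 1 ≤ (A.filter fun z => ω ∈ openConn o z).card ∧
    (A.filter fun z => ω ∈ openConn o z).card ≤ j} with hL
  have hmeas : ∀ S : Set (BondConfig (Fin n)), MeasurableSet S := fun S => (Set.toFinite S).measurableSet
  -- almost surely the coin is open
  set Op : Set (BondConfig (Fin n)) := {ω | s(o, c) ∈ ω} with hOp
  have hOpae : ∀ᵐ ω ∂μ, ω ∈ Op := prodBernoulli_ae_mem_of_eq_one v hvc
  -- on Op: o ↔ c, c ∈ pat ω
  have hreach : ∀ ω ∈ Op, (openGraph ω).Reachable o c := by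
    intro ω hω
    have hadj : (openGraph ω).Adj o c := by rw [openGraph_adj]; exact ⟨hω, hco.symm⟩
    exact hadj.reachable
  have hcpat : ∀ ω ∈ Op, c ∈ pat ω := by
    intro ω hω
    have hins : insert s(o, c) ω = ω := insert_eq_of_mem hω
    have := openConnIn_insert_coin_self ω A hoA hco.symm
    rw [hins] at this
    exact Finset.mem_filter.2 ⟨hcA, this⟩
  -- (1) μ(L) = μ(R c)
  have hLR : μ.real L = μ.real (R c) := by
    refine measureReal_congr (hOpae.mono fun ω hω => ?_)
    have heq : (A.filter fun z => ω ∈ openConn o z) = A.filter fun z => ω ∈ openConn c z := by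
      apply Finset.filter_congr
      intro z _
      exact ⟨fun h => ((hreach ω hω).symm.trans h : (openGraph ω).Reachable c z),
        fun h => ((hreach ω hω).trans h : (openGraph ω).Reachable o z)⟩
    have key : ω ∈ L ↔ ω ∈ R c := by
      simp only [hL, hR, mem_setOf_eq]
      rw [heq]
      constructor
      · exact fun h => h.2
      · intro h
        refine ⟨Finset.card_pos.2 ⟨c, Finset.mem_filter.2 ⟨hcA, ?_⟩⟩, h⟩
        exact (SimpleGraph.Reachable.refl c : (openGraph ω).Reachable c c)
    exact propext key
  -- (2) Σ_b μ(Sel b) ≥ 1 : the selection events cover Op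
  have hcover : Op ⊆ ⋃ b ∈ A, Sel b := by
    intro ω hω
    have hne : (pat ω).Nonempty := ⟨c, hcpat ω hω⟩
    obtain ⟨b, hb, hmin⟩ := Finset.exists_min_image (pat ω) r hne
    rw [mem_iUnion₂]
    refine ⟨b, (Finset.mem_filter.1 hb).1, hb, fun b' _ hlt hb' => ?_⟩
    exact absurd (hmin b' hb') (not_le.2 hlt)
  have hdisj : (↑A : Set (Fin n)).PairwiseDisjoint Sel := by
    intro b₁ h₁ b₂ h₂ hne
    exact sel_disjoint A r hr o (Finset.mem_coe.1 h₁) (Finset.mem_coe.1 h₂) hne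
  have hsum_ge : 1 ≤ ∑ b ∈ A, μ.real (Sel b) := by
    rw [← measureReal_biUnion_finset hdisj (fun b _ => hmeas _)]
    have h1 : μ.real Op = 1 := by
      have : μ.real Op = μ.real (univ : Set (BondConfig (Fin n))) := by
        refine measureReal_congr (hOpae.mono fun ω hω => ?_)
        have key : ω ∈ Op ↔ ω ∈ (univ : Set (BondConfig (Fin n))) := ⟨fun _ => mem_univ ω, fun _ => hω⟩
        exact propext key
      rw [this, probReal_univ]
    rw [← h1]
    exact measureReal_mono hcover (measure_ne_top _ _)
  -- (3) termwise: μ(Sel b)·μ(R b) ≥ μ(Sel b)·μ(R c)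
  have hterm : ∀ b ∈ A, μ.real (Sel b) * μ.real (R c) ≤ μ.real (Sel b) * μ.real (R b) := by
    intro b hbA
    by_cases hgt : r c < r b
    · -- b is never selected: Sel b ∩ Op = ∅
      have h0 : μ.real (Sel b) = 0 := by
        have : μ.real (Sel b) = μ.real (∅ : Set (BondConfig (Fin n))) := by
          refine measureReal_congr (hOpae.mono fun ω hω => ?_)
          have hins : insert s(o, c) ω = ω := insert_eq_of_mem hω
          have hnot := sel_insert_of_gt ω A r hoA hcA hgt (b := b)
          rw [hins] at hnot
          have key : ω ∈ Sel b ↔ ω ∈ (∅ : Set (BondConfig (Fin n))) :=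
            ⟨fun h => absurd h hnot, fun h => absurd h (Set.notMem_empty ω)⟩
          exact propext key
        rw [this, measureReal_empty]
      rw [h0, zero_mul, zero_mul]
    · apply mul_le_mul_of_nonneg_left _ measureReal_nonneg
      have hbo : b ≠ o := fun h => hoA (h ▸ hbA)
      by_cases hbc : b = c
      · rw [hbc]
      · have hlt : r b < r c := by
          have hne : r b ≠ r c := fun h => hbc (hr (Finset.mem_coe.2 hbA) (Finset.mem_coe.2 hcA) h)
          rcases lt_or_gt_of_ne hne with h | h
          · exact h
          · exact absurd h hgt
        exact attachmentMono v A j hco hbo hvc (hcompat b hbA c hcA hlt)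
  -- assemble
  calc μ.real L = μ.real (R c) := hLR
    _ ≤ (∑ b ∈ A, μ.real (Sel b)) * μ.real (R c) := by
        have := mul_le_mul_of_nonneg_right hsum_ge (measureReal_nonneg (μ := μ) (s := R c))
        rwa [one_mul] at this
    _ = ∑ b ∈ A, μ.real (Sel b) * μ.real (R c) := by rw [Finset.sum_mul]
    _ ≤ ∑ b ∈ A, μ.real (Sel b) * μ.real (R b) := Finset.sum_le_sum hterm

end CoinReduction

end Summit.CriticalPhenomena.PercolationContinuityZ3.Theorems

end
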